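import Mathlib
import HarnessLib

/-!
# The trace form of a totally real number field is positive definite; trace-zero slices are
square-difference-free

Topic `Literature/NumberTheory/NumberFields`.  For a totally real number field `K` and `z ∈ K`,
`Tr_{K/ℚ}(z²) = Σ_σ σ(z)²` over the (real) embeddings `σ`, so `Tr(z²) > 0` unless `z = 0`:
the trace form is positive definite (C. Pohoata, *The sharp exponent for the minimal distance
problem*, arXiv:2607.20422 (2026), Observation 3.1; classical).  Consequently the trace-zero
hyperplane contains no non-zero square (Pohoata, eq. (20)), and any set of elements of trace
zero has no two members differing by a non-zero square (Pohoata, Proposition 3.2 — the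
"trace-zero slice" that replaces Ruzsa's square-difference-free digit sets in the number-field
constructions of induced point–line matchings of size `q^{3/2 − 1/d}` over prime fields and of
point–line configurations attaining the sharp exponent `2/3` of the minimal distance problem).

* `trace_sq_pos` — `K` totally real, `z ≠ 0` ⇒ `0 < Tr_{K/ℚ}(z²)`;
* `eq_zero_of_trace_sq_eq_zero` — `Tr(z²) = 0 ⇒ z = 0`;
* `sqDiffFree_of_trace_eq_zero` — if all members of `A ⊆ K` have trace `0`, then
  `a - a' = z² ⇒ z = 0` for `a, a' ∈ A`.

Mathlib ingredients: `trace_eq_sum_embeddings` (trace = sum over `K →ₐ[ℚ] ℂ`) and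
`NumberField.IsTotallyReal` (every `K →+* ℂ` is real).  No definitions.

## References
* C. Pohoata, arXiv:2607.20422 (2026), Observation 3.1, eq. (20), Proposition 3.2.
  [Pohoata2026SharpExponentMinimalDistance]
-/

namespace Literature.NumberTheory.NumberFields

open NumberField

variable {K : Type*} [Field K] [NumberField K]

/-- **Positive definiteness of the trace form (totally real fields).**  If `K` is a totally real
number field and `z ≠ 0` then `0 < Tr_{K/ℚ}(z²)`: under any embedding into `ℂ` the trace of `z²`
becomes `Σ_σ σ(z)²`, a sum of squares of non-zero REAL numbers.
[cite: Pohoata2026SharpExponentMinimalDistance, Observation 3.1] -/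
theorem trace_sq_pos [IsTotallyReal K] {z : K} (hz : z ≠ 0) :
    0 < Algebra.trace ℚ K (z ^ 2) := by
  classical
  -- trace as a sum over the complex embeddings
  have key : ((Algebra.trace ℚ K (z ^ 2) : ℚ) : ℂ) = ∑ σ : K →ₐ[ℚ] ℂ, (σ z) ^ 2 := by
    have h := trace_eq_sum_embeddings ℂ (K := ℚ) (L := K) (x := z ^ 2)
    rw [eq_ratCast] at h
    simpa only [map_pow] using h
  -- every embedding is real: `σ z` is a real number, non-zero since `σ` is injective
  have hreal : ∀ σ : K →ₐ[ℚ] ℂ, (σ z).im = 0 := fun σ =>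
    Complex.conj_eq_iff_im.mp
      (RingHom.congr_fun (IsTotallyReal.complexEmbedding_isReal (σ : K →+* ℂ)) z)
  have hne : ∀ σ : K →ₐ[ℚ] ℂ, (σ z).re ≠ 0 := by
    intro σ h0
    have : σ z = 0 := Complex.ext h0 (hreal σ)
    exact hz ((map_eq_zero_iff σ (RingHom.injective (σ : K →+* ℂ))).mp this)
  -- compute real and imaginary parts of the sum
  have hsq : ∀ σ : K →ₐ[ℚ] ℂ, (σ z) ^ 2 = (((σ z).re ^ 2 : ℝ) : ℂ) := by
    intro σ
    have hre : σ z = ((σ z).re : ℂ) := Complex.ext rfl (by simp [hreal σ])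
    conv_lhs => rw [hre]
    push_cast
    ring
  have hsum : ((Algebra.trace ℚ K (z ^ 2) : ℚ) : ℂ) =
      ((∑ σ : K →ₐ[ℚ] ℂ, (σ z).re ^ 2 : ℝ) : ℂ) := by
    rw [key]
    push_cast
    exact Finset.sum_congr rfl fun σ _ => by rw [hsq σ]; push_cast; ring
  -- the real sum is positive: all terms are non-negative and there is at least one embedding
  have hpos : 0 < ∑ σ : K →ₐ[ℚ] ℂ, (σ z).re ^ 2 := by
    have hnonempty : (Finset.univ : Finset (K →ₐ[ℚ] ℂ)).Nonempty := by
      have hcard : Fintype.card (K →ₐ[ℚ] ℂ) = Module.finrank ℚ K := AlgHom.card ℚ K ℂ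
      have hpos : 0 < Fintype.card (K →ₐ[ℚ] ℂ) := by
        rw [hcard]; exact Module.finrank_pos
      obtain ⟨σ⟩ := Fintype.card_pos_iff.mp hpos
      exact ⟨σ, Finset.mem_univ _⟩
    apply Finset.sum_pos _ hnonempty
    intro σ _
    have := hne σ
    positivity
  -- transfer back to `ℚ`
  have hq : ((Algebra.trace ℚ K (z ^ 2) : ℚ) : ℝ) = ∑ σ : K →ₐ[ℚ] ℂ, (σ z).re ^ 2 := by
    have h1 : (((Algebra.trace ℚ K (z ^ 2) : ℚ) : ℝ) : ℂ) = ((Algebra.trace ℚ K (z ^ 2) : ℚ) : ℂ) :=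
      by norm_cast
    exact_mod_cast (h1.trans hsum)
  exact_mod_cast (hq ▸ hpos : (0 : ℝ) < ((Algebra.trace ℚ K (z ^ 2) : ℚ) : ℝ))

/-- In a totally real number field, `Tr(z²) = 0` forces `z = 0` (no non-zero square lies in the
trace-zero hyperplane). [cite: Pohoata2026SharpExponentMinimalDistance, eq. (20)] -/
theorem eq_zero_of_trace_sq_eq_zero [IsTotallyReal K] {z : K}
    (h : Algebra.trace ℚ K (z ^ 2) = 0) : z = 0 := by
  by_contra hz
  exact (trace_sq_pos hz).ne' h

/-- **Trace-zero slices are square-difference-free.**  If every member of `A ⊆ K` (a totally real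
number field) has trace zero, then no two members of `A` differ by a non-zero square:
`a - a' = z² ⇒ z = 0`.  This is the square-difference-free input of Pohoata's number-field
parabola lift (applied to `A ⊆ 2𝒪_K`, where it has `≍ X^{d-1}` members in a box of side `X`).
[cite: Pohoata2026SharpExponentMinimalDistance, Proposition 3.2] -/
theorem sqDiffFree_of_trace_eq_zero [IsTotallyReal K] {A : Set K}
    (hA : ∀ a ∈ A, Algebra.trace ℚ K a = 0) {a a' : K} (ha : a ∈ A) (ha' : a' ∈ A)
    {z : K} (hz : a - a' = z ^ 2) : z = 0 := by
  apply eq_zero_of_trace_sq_eq_zero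
  rw [← hz, map_sub, hA a ha, hA a' ha', sub_self]

end Literature.NumberTheory.NumberFields
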